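import Summits.QuantumFields.BalabanUV.T4Continuum.Support.NE7QbarIterL1DbarFree
import Summits.QuantumFields.BalabanUV.T4Continuum.Support.NE7QbarIterL2DbarFree
import Summits.QuantumFields.BalabanUV.T4Continuum.Support.NE7TopDbarFieldAtPair
import HarnessLib

/-!
# Support | NE7 (gen 96, ROAD-G96 §7∕§9: (Γ1) ∘ (Γ2) composed): AT NE7's PAIR THE LINEARISED TOP STRAIGHT AVERAGE OF A CORNER-TRIVIAL REPRESENTATIVE SPLITS AS
# `QbarIter L (k+1) U_s X = T + Rem`, `T = Ad_{Ū}⁻¹ log((D^{v⁻¹})·D⁻¹)` AN EXACT TOP PURE GAUGE OF THE ACCUMULATED FRAME `v`, with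
# `dirL1 Rem ≤ 64C₁L²d(4L+1)^d((L∕L^d)L)^k·l2sq X` and `√l2sq Rem ≤ 32C₁L²√(d(4L+1)^d)·√l2sq X·sup‖X‖·(√(L²∕L^d)L)^k` — k-FREE, NO frame condition

Cell `pub-balaban`, rung (B)+1 sub-cell t4, lineage `b2b-balaban-t4-ne7-p1` (CRUX PROVER NE7 #1 = OWNER of row NE7), generation 96; memo `t4/b2b-balaban-t4-ne7-p1-g96/ROAD-G96.md` §7(d)∕§9.
Pure composition of this generation's `NE7QbarIterL1DbarFree.dirL1_QbarIter_sub_le`, `NE7QbarIterL2DbarFree.sqrt_l2sq_QbarIter_sub_le` ((Γ1): NE3's R26′ towers WITHOUT `hdbar`) with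
`NE7TopDbarFieldAtPair.logCovIter_top_eq_mlog_frameGauge` ((Γ2): the top double-bar field of a corner-trivial representative at a pair with common plain average is the logarithm of the
pure gauge of the accumulated frame).  THE ENTRY POINT of ROAD-Γ for the successor's supplier (Γ4)∕(Γ5): the remainder `Rem` is fed to the right inverse ((R1)–(R3) letters,
k-free), the top pure gauge `T` is removed by the gauge adjustment `u ↦ u·ṽ` at the top corners (dS-invisible; third-order residues).
WHAT ([folklore]; 0 def, 0 sorry): **`dirL1_QbarIter_sub_topGauge_le`**, **`sqrt_l2sq_QbarIter_sub_topGauge_le`** — hypotheses: the tower class at `W = U_s` (`2 ≤ L`, `1 ≤ N`, unitary,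
`(N·L^{k})`-periodic, `LevelSmall d L (k−1) x`, `SmallField W x`), the [B7]-Prop-4 regime (`α₀`, `b`, the four lines of (Γ1)), `X` sup-`b` and periodic, the pair data `U′^{u} = W e^{X}`,
`u` corner-trivial, `Ū′^{k} = D = W̄^{k}`.
HONEST FRAMING (page 1): composition of landed kernel theorems; nothing of Bałaban's asserted; (Γ3)∕(Γ4)∕(Γ5), `hdecomp♭`, NE7, NE3 NOT proved; spine 0∕9; finite T⁴ rung (B)+1 — NOT infinite
volume, NOT mass gap, NOT `BetaPertH`, NOT Clay.  Continuum YM on T⁴ ⇐ BetaPertH ∧ nine spine estimates (0/9 proved); BetaPertH ⇐ (D1) ∧ (D4) ∧ CAP+tail; G-an2-4 gates asym, D1 and NE2/3/4.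
-/

set_option autoImplicit false

open scoped BigOperators Matrix Matrix.Norms.L2Operator
open NormedSpace Finset

namespace Summit.QuantumFields.BalabanUV.T4Continuum.NE7QbarTopSplitAtPair

open Literature.MathematicalPhysics.QuantumFieldTheory.Balaban1983to89
open B7Prop1Explicit B7Prop2Explicit B7Prop3Flat MatrixLog
open T4AveragingDeficitWall (Ad IsUnitaryCfg SmallField vary dirL1)
open T4AveragingDeficitWallBoundary (IsPeriodicCfg periodBox)
open AveragingDeficitPeriodicCounting (IsPeriodicDir)
open AveragingDeficitMultiLevelPrep (cavgIter LevelSmall)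
open B7AvgGaugeCovariance (uLev)
open B7Eq92Concrete (vcov dbavgCovIter)
open B7Prop4GeneralLevels (logCovIter)
open NE3TangentCovariantTower (QbarIter)
open NE3CovariantLineSumsL2 (l2sq)
open NE3.PairLandauB8Avg (relPert)
open NE3.QbarDictionary (adField)
open ReplicationRightInverseBound (radSum)
open BlockAverageVaryHolo (nbRad)
open NE3CovariantLineSumsError (Csup)
open ShellMeasureAverageProp4General (C1cov)
open NE7QbarIterL1DbarFree (dirL1_QbarIter_sub_le)
open NE7QbarIterL2DbarFree (sqrt_l2sq_QbarIter_sub_le)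
open NE7TopDbarFieldAtPair (logCovIter_top_eq_mlog_frameGauge)

noncomputable section

variable {d : ℕ} {n : Type*} [Fintype n] [DecidableEq n]

/-- **THE ℓ¹ HALF OF THE SPLIT**: `dirL1 (QbarIter L (j+1) W X − Ad_{Ū}⁻¹ log((D^{v⁻¹})·D⁻¹)) (periodBox N) ≤ 64C₁L²d(4L+1)^d·((L∕L^d)L)^j·l2sq X` at NE7's pair
(`Ū = cavgIter L (j+1) W`, `v = vcov L W (relPert W X) (j+1)`; hypotheses of `NE7QbarIterL1DbarFree.dirL1_QbarIter_sub_le` + the pair data). [folklore] -/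
theorem dirL1_QbarIter_sub_topGauge_le [Nonempty n] {L N : ℕ} (hL : 2 ≤ L) (hN : 1 ≤ N) (j : ℕ)
    {W UA D : Site d → Fin d → (Matrix n n ℂ)ˣ} {u : Site d → (Matrix n n ℂ)ˣ} {x : ℝ} (hWu : IsUnitaryCfg W) (hWP : IsPeriodicCfg W ((N * L ^ (j + 1) : ℕ) : ℤ))
    (hx : 0 ≤ x) (hsm : LevelSmall d L j x) (hWx : SmallField W x)
    {α₀ b : ℝ} (hα : 0 < α₀) (hα3 : C0 d * (2 * α₀) ≤ 1 / 3) (hα4 : 4 * (2 * α₀) ≤ c2' d L)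
    (h52 : pdev W < α₀ * (((L : ℝ) ^ (j + 1))⁻¹) ^ 2) (hb : 0 ≤ b)
    {X : Site d → Fin d → Matrix n n ℂ} (hX : ∀ (y : Site d) (κ : Fin d), ‖X y κ‖ ≤ b) (hXP : IsPeriodicDir X ((N * L ^ (j + 1) : ℕ) : ℤ))
    (hsmall : Real.exp (4 * (800 * ((d : ℝ) + 1) ^ 2 * ((d : ℝ) + 4)) * α₀)
      * (1 + 8 * (131072 * ((d : ℝ) + 1) ^ 2) * ((L : ℝ) ^ (j + 1) * b)) ≤ 2)
    (hc₃ : 4 * ((L : ℝ) ^ (j + 1) * b) ≤ c3 d L)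
    (hK : 16 * (C1cov d * (L : ℝ) ^ 2 * Real.sqrt (d * (2 * (2 * L) + 1) ^ d)) * (L : ℝ) ^ (j + 1) * b ≤ Real.sqrt ((L : ℝ) ^ 2 / (L : ℝ) ^ d))
    (hS1 : (16 * (d + 1) * (d + 4) * (L : ℝ) ^ 2 * Csup d L * (d * (2 * nbRad d L + 1) ^ d)) * radSum d L j x ≤ ((L : ℝ) / (L : ℝ) ^ d) / 2)
    (hrep : gaugeAct u UA = vary W X 1) (hcorner : ∀ z : Site d, u (((L : ℤ) ^ (j + 1)) • z) = 1)
    (hA : avgIter L UA (j + 1) = D) (hW : avgIter L W (j + 1) = D) :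
    dirL1 (fun z κ => QbarIter L (j + 1) W X z κ
        - Ad ((cavgIter L (j + 1) W) z κ)⁻¹ (mlog ((gaugeAct (vcov L W (relPert W X) (j + 1))⁻¹ D z κ * (D z κ)⁻¹ : (Matrix n n ℂ)ˣ) : Matrix n n ℂ)))
        (periodBox (d := d) N)
      ≤ 64 * (C1cov d * (L : ℝ) ^ 2 * (d * (2 * (2 * (L : ℝ)) + 1) ^ d)) * (((L : ℝ) / (L : ℝ) ^ d) * L) ^ (j + 1 - 1)
          * l2sq (periodBox (d := d) (N * L ^ (j + 1))) X := by
  have hα3' : C0 d * α₀ ≤ 1 / 3 := by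
    have hC : 0 ≤ C0 d := by unfold C0; positivity
    nlinarith
  have hα4' : 4 * α₀ ≤ c2' d L := by linarith
  have hL0 : (0 : ℝ) < L := by exact_mod_cast (show 0 < L by omega)
  have hc₃' : 2 * ((L : ℝ) ^ (j + 1) * b) ≤ c3 d L := by nlinarith [pow_pos hL0 (j + 1)]
  have hT : ∀ (z : Site d) (κ : Fin d), logCovIter L W (adField W X) (j + 1) z κ
      = mlog ((gaugeAct (vcov L W (relPert W X) (j + 1))⁻¹ D z κ * (D z κ)⁻¹ : (Matrix n n ℂ)ˣ) : Matrix n n ℂ) :=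
    fun z κ => logCovIter_top_eq_mlog_frameGauge hL j hWu hrep hcorner hA hW hα hα3' hα4' h52 hb hX hsmall hc₃' z κ
  have h := dirL1_QbarIter_sub_le hL hN j hWu hWP hx hsm hWx hα hα3 hα4 h52 hb hX hXP hsmall hc₃ hK hS1
  have e : (fun z κ => QbarIter L (j + 1) W X z κ
        - Ad ((cavgIter L (j + 1) W) z κ)⁻¹ (mlog ((gaugeAct (vcov L W (relPert W X) (j + 1))⁻¹ D z κ * (D z κ)⁻¹ : (Matrix n n ℂ)ˣ) : Matrix n n ℂ)))
      = (fun z κ => QbarIter L (j + 1) W X z κ - Ad ((cavgIter L (j + 1) W) z κ)⁻¹ (logCovIter L W (adField W X) (j + 1) z κ)) := by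
    funext z κ; rw [hT z κ]
  rw [e]
  exact h

/-- **THE ℓ² HALF OF THE SPLIT**: `√l2sq (periodBox N) (QbarIter L (j+1) W X − Ad_{Ū}⁻¹ log((D^{v⁻¹})·D⁻¹)) ≤ 32C₁L²√(d(4L+1)^d)·√l2sq X·b·(√(L²∕L^d)L)^j` at NE7's pair
(hypotheses of `NE7QbarIterL2DbarFree.sqrt_l2sq_QbarIter_sub_le` + the pair data). [folklore] -/
theorem sqrt_l2sq_QbarIter_sub_topGauge_le [Nonempty n] {L N : ℕ} (hL : 2 ≤ L) (hN : 1 ≤ N) (j : ℕ)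
    {W UA D : Site d → Fin d → (Matrix n n ℂ)ˣ} {u : Site d → (Matrix n n ℂ)ˣ} {x : ℝ} (hWu : IsUnitaryCfg W) (hWP : IsPeriodicCfg W ((N * L ^ (j + 1) : ℕ) : ℤ))
    (hx : 0 ≤ x) (hsm : LevelSmall d L j x) (hWx : SmallField W x)
    {α₀ b : ℝ} (hα : 0 < α₀) (hα3 : C0 d * (2 * α₀) ≤ 1 / 3) (hα4 : 4 * (2 * α₀) ≤ c2' d L)
    (h52 : pdev W < α₀ * (((L : ℝ) ^ (j + 1))⁻¹) ^ 2) (hb : 0 ≤ b)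
    {X : Site d → Fin d → Matrix n n ℂ} (hX : ∀ (y : Site d) (κ : Fin d), ‖X y κ‖ ≤ b) (hXP : IsPeriodicDir X ((N * L ^ (j + 1) : ℕ) : ℤ))
    (hsmall : Real.exp (4 * (800 * ((d : ℝ) + 1) ^ 2 * ((d : ℝ) + 4)) * α₀)
      * (1 + 8 * (131072 * ((d : ℝ) + 1) ^ 2) * ((L : ℝ) ^ (j + 1) * b)) ≤ 2)
    (hc₃ : 4 * ((L : ℝ) ^ (j + 1) * b) ≤ c3 d L)
    (hK : 16 * (C1cov d * (L : ℝ) ^ 2 * Real.sqrt (d * (2 * (2 * L) + 1) ^ d)) * (L : ℝ) ^ (j + 1) * b ≤ Real.sqrt ((L : ℝ) ^ 2 / (L : ℝ) ^ d))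
    (hrep : gaugeAct u UA = vary W X 1) (hcorner : ∀ z : Site d, u (((L : ℤ) ^ (j + 1)) • z) = 1)
    (hA : avgIter L UA (j + 1) = D) (hW : avgIter L W (j + 1) = D) :
    Real.sqrt (l2sq (periodBox (d := d) N) (fun z κ => QbarIter L (j + 1) W X z κ
        - Ad ((cavgIter L (j + 1) W) z κ)⁻¹ (mlog ((gaugeAct (vcov L W (relPert W X) (j + 1))⁻¹ D z κ * (D z κ)⁻¹ : (Matrix n n ℂ)ˣ) : Matrix n n ℂ))))
      ≤ 32 * (C1cov d * (L : ℝ) ^ 2 * Real.sqrt (d * (2 * (2 * L) + 1) ^ d))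
          * Real.sqrt (l2sq (periodBox (d := d) (N * L ^ (j + 1))) X) * b * (Real.sqrt ((L : ℝ) ^ 2 / (L : ℝ) ^ d) * L) ^ (j + 1 - 1) := by
  have hα3' : C0 d * α₀ ≤ 1 / 3 := by
    have hC : 0 ≤ C0 d := by unfold C0; positivity
    nlinarith
  have hα4' : 4 * α₀ ≤ c2' d L := by linarith
  have hL0 : (0 : ℝ) < L := by exact_mod_cast (show 0 < L by omega)
  have hc₃' : 2 * ((L : ℝ) ^ (j + 1) * b) ≤ c3 d L := by nlinarith [pow_pos hL0 (j + 1)]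
  have hT : ∀ (z : Site d) (κ : Fin d), logCovIter L W (adField W X) (j + 1) z κ
      = mlog ((gaugeAct (vcov L W (relPert W X) (j + 1))⁻¹ D z κ * (D z κ)⁻¹ : (Matrix n n ℂ)ˣ) : Matrix n n ℂ) :=
    fun z κ => logCovIter_top_eq_mlog_frameGauge hL j hWu hrep hcorner hA hW hα hα3' hα4' h52 hb hX hsmall hc₃' z κ
  have h := sqrt_l2sq_QbarIter_sub_le hL hN j hWu hWP hx hsm hWx hα hα3 hα4 h52 hb hX hXP hsmall hc₃ hK
  have e : (fun z κ => QbarIter L (j + 1) W X z κ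
        - Ad ((cavgIter L (j + 1) W) z κ)⁻¹ (mlog ((gaugeAct (vcov L W (relPert W X) (j + 1))⁻¹ D z κ * (D z κ)⁻¹ : (Matrix n n ℂ)ˣ) : Matrix n n ℂ)))
      = (fun z κ => QbarIter L (j + 1) W X z κ - Ad ((cavgIter L (j + 1) W) z κ)⁻¹ (logCovIter L W (adField W X) (j + 1) z κ)) := by
    funext z κ; rw [hT z κ]
  rw [e]
  exact h

end

end Summit.QuantumFields.BalabanUV.T4Continuum.NE7QbarTopSplitAtPair
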